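import Literature.NumberTheory.Rogawski1990.UnitStableOrbitalIntegralHSideValue     -- ★ (L5) value file: `natCard_fixedBy_eq_ncard_selfDualStable_antidiagTwo`, `ncard_selfDualStable_zpow_smul_one_eq_sum_at`, `map_eval_mul_eq_of_eigenframe`, `injective_eval_and_norm_one_of_eigenvalues`, `twistGram_apply_eval`; brings ★ `exists_ncard_selfDualStable_antidiagTwo_eq_zpow_smul_one`, ★ `coe_localNonsplitEquiv_apply`, ★ `localForm_map_eval`
import Literature.NumberTheory.Automorphic.UniformizerModularStableLatticeCount      -- ★ A-p03: `ncard_selfDualStable_add_ncard_modularStable_antidiagTwo_eq_sum_at` (ALL fixed vertices = `Σ_{j ≤ N} w`)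
import Literature.NumberTheory.Automorphic.UnitOrbitalIntegralHSideGluingSum         -- ★ `HSideGluingSum.sum_gluingWeight_eq`, `pred_mul_sum_gluingWeight_add_two`, `cast_sum_gluingWeight_eq_div`
import HarnessLib

/-!
# K2 ∕ E3 «EllipticInputs», sub-line «U3b-c RANK-ONE GERMS», letter (ii♭-S) at an UNRAMIFIED non-split place — `K2E3RankOneEllipticFixedPointCount`:
# the `δ`-FIXED VERTICES of the `(q+1)`-regular tree of `U(Φ₂)(L⁺_v)` for an elliptic unramified regular `δ` of depth `n = v(D(δ))∕2` number `1 + (q+1)(qⁿ − 1)∕(q − 1)`,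
# and the type-`K` half (`= #Fix_δ(U₂ ⧸ K₂)`, the reading of `Φ(δ, 1_{K₂})`) is `(q^{n+[n≡e]} − 1)∕(q − 1)` — CLOSED FORMS with constant term `−1∕(q−1)` for every class

Cell `hodgecm-mathlib` (Track B «K2-LIT»), engine E3, crux H413 = `stmt-HodgeConjecture-24833`; dealt by K2E3-plan (g1) DEALER LINE 2026-09-03T23:27:26Z (2)(a) to the free E5 hand
K2E5-p11 (g2); line lead (ii) K2E4-p06 (g2), MEMO (ii) 77d54c9e69b21b78 §4 (ii♭-S) «SIGN: the trivial-class germ is a NEGATIVE constant near 1 … for `f = 1_K`, `Φ(δ, 1_K) =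
#Fix_δ·ν(K)`, `#Fix_δ` = vertices of the `(q+1)`-regular tree within distance `n = v(D(δ))∕2` … `= 1 + (q+1)(qⁿ−1)∕(q−1)`, whose `q^n`-free part is `< 0`».  PROOF lane, THEOREMS
ONLY (no `def`, no `instance`, no `notation`, no named-fact hypothesis, no `sorry`); `--supports stmt-HodgeConjecture-24833 --as helper` (count-neutral).

★ CENSUS (this file is a thin closed-form layer over the cell's lattice-tree library, nothing is re-proved): at a finite place `v` of `L⁺` NON-SPLIT (`c • w = w`) and UNRAMIFIED
in the CM field `L`, on the tree of self-dual ⊔ `ϖ_w`-modular lattices of `(L_w², (Φ₂)_w)` (★ `HermitianLatticeTree*`; the Bruhat–Tits tree of `U(1,1)(L⁺_v)`, `(q_v+1)`-regular,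
two vertex types), a TYPE-(1) = «elliptic unramified regular» element is `γ ∈ U(σ_w, (Φ₂)_w)` with an eigenframe `γ P = P · diag(u₀, u₁)` over `L_w`, `u₀ ≠ u₁` of norm one, and its
DEPTH is `N` with `|u₀ − u₁|_w = |ϖ_w^N|` (= `v(D(δ))∕2` for the Weyl discriminant `D = (u₀ − u₁)²∕u₀u₁`, `w ∣ v` unramified).  ★ A-p03
`ncard_selfDualStable_add_ncard_modularStable_antidiagTwo_eq_sum_at`: `#S(γ) + #M(γ) = Σ_{j ≤ N} w(q_v, j)` (ALL fixed vertices; `w(0) = 1`, `w(j) = q^{j−1}(q+1)` = the sphere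
sizes of the `(q+1)`-regular tree); ★ B-p10∕A-p13 (L5-d1) `exists_ncard_selfDualStable_antidiagTwo_eq_zpow_smul_one` + ★ `ncard_selfDualStable_zpow_smul_one_eq_sum_at`: the SELF-DUAL
half `#S(γ) = Σ_{j ≤ N, j ≡ e} w` with the class bit `e ∈ {0, 1}` (`e = 0 ⟺` the order of the Gram entry `⟨p₀, p₀⟩` is even); ★ `natCard_fixedBy_eq_ncard_selfDualStable_antidiagTwo`:
on the CM carrier `U₂ = (cmDatum L 2 Φ₂).Local v`, `#Fix_δ(U₂ ⧸ K₂) = #S(δ_w)`; ★ `HSideGluingSum.*`: `Σ_{j ≤ N} w = (q^N(q+1) − 2)∕(q − 1)`.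
THIS FILE ADDS: §1 the CLOSED FORM OF THE PARITY SUMS `(q − 1)·Σ_{j ≤ N, j ≡ e} w + 1 = q^{N + [N ≡ e (2)]}` (so the per-class count is `(q^{N+[N≡e]} − 1)∕(q − 1) =
−1∕(q−1) + q^{[N≡e]}∕(q−1) · q^N`: constant term `−1∕(q−1) < 0` for BOTH classes — the (ii♭-S) sign — and `q^N = |D(δ)|_v^{−1∕2}`); §2 the dealt literal «ALL fixed vertices
`= 1 + (q+1)(q^N − 1)∕(q − 1)`» at `w`; §3 the CM-carrier count for `U₂` ALONE, measure-free: `#Fix_δ(U₂ ⧸ K₂) = Σ_{j ≤ N, j ≡ e} w` and its closed form, from an eigenframe of `δ` over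
`E_v = Π_{w∣v} L_w` (the chain of ★ `exists_classOrbitalIntegral_indicator_eq_paritySum` without the orbital measure).
HONEST LABEL: HC_CM is proved only modulo the 7 printed citations (2 remaining named inputs: hLiu418 = stmt-HodgeConjecture-24832, h413 = stmt-HodgeConjecture-24833) until rung 0
closes; count-neutral helper (one input of (ii♭-S); the germ-expansion letters (ii♭-E)∕(ii♭-H) are untouched).

## References
* [Kottwitz1988] R. E. Kottwitz, *Tamagawa numbers*, Ann. of Math. 127 (1988), §2 (fixed points of elliptic elements on the building; `O_γ(f_EP) = χ(X^γ)`).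
* [Flicker1998UnitaryFL] Y. Z. Flicker, *Elementary proof of the fundamental lemma for a unitary group*, Canad. J. Math. 50 (1998), §6 p. 95 and REMARK (`(q^N(q+1) − 2)∕(q−1)`).
* [Rogawski1990] J. D. Rogawski, *Automorphic Representations of Unitary Groups in Three Variables* (1990), §4.9 p. 54–56; §8.1 Props. 8.1.1–8.1.2, p. 117 (constant germ).
* [Serre1980Trees] J.-P. Serre, *Trees* (1980), Ch. II §1.1 (the tree of a rank-one group over a local field; spheres of radius `j` have `q^{j−1}(q+1)` vertices).
-/

set_option autoImplicit false
-- the mandated namespace repeats the single-problem summit's segment (`HodgeConjecture.HodgeConjecture`)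
set_option linter.dupNamespace false

noncomputable section

namespace Summit.HodgeConjecture.HodgeConjecture.Cruxes.H413.K2E3RankOneEllipticFixedPointCount

open Finset NumberField IsDedekindDomain Matrix ValuativeRel
open scoped ValuativeRel Matrix MatrixGroups
open Literature.NumberTheory.Automorphic Literature.NumberTheory.Automorphic.UnitaryGroup
open Literature.NumberTheory.Rogawski1990 Literature.NumberTheory.GaloisRepresentations

/-! ## §1 Closed forms of the parity sums of the sphere sizes `w(0) = 1`, `w(j) = q^{j−1}(q+1)` -/

section Arithmetic

/-- **`(q − 1) · Σ_{j ≤ N, j ≡ e (2)} w(j) + 1 = q^{N + [N ≡ e (2)]}`** (`1 ≤ q`, `e ∈ {0,1}`): the vertices of ONE type in the ball of radius `N` of the `(q+1)`-regular tree number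
`(q^{N+1} − 1)∕(q − 1)` if the centre has that type's parity (`N ≡ e`) and `(q^N − 1)∕(q − 1)` otherwise (induction on `N`: adding the sphere `w(N+1) = q^N(q+1)` when `N + 1 ≡ e`,
`(q−1)(q+1) + 1 = q²`). [cite: Serre1980Trees, Ch. II §1.1] [cite: Kottwitz1988, §2] -/
theorem pred_mul_paritySum_add_one {q : ℕ} (hq : 1 ≤ q) {e : ℕ} (he : e ≤ 1) (N : ℕ) :
    (q - 1) * (∑ j ∈ (range (N + 1)).filter (fun j => j % 2 = e), (if j = 0 then 1 else q ^ (j - 1) * (q + 1))) + 1 =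
      q ^ (N + if N % 2 = e then 1 else 0) := by
  obtain ⟨d, rfl⟩ := Nat.exists_eq_add_of_le' hq
  rw [Nat.add_sub_cancel]
  induction N with
  | zero =>
    rcases Nat.le_one_iff_eq_zero_or_eq_one.1 he with rfl | rfl
    · rw [zero_add, Finset.range_one, Finset.filter_singleton, if_pos rfl, Finset.sum_singleton, if_pos rfl, if_pos rfl, mul_one, pow_one]
    · rw [zero_add, Finset.range_one, Finset.filter_singleton, if_neg (by decide), Finset.sum_empty, mul_zero, zero_add, if_neg (by decide), pow_zero]
  | succ N ih =>
    rw [Finset.range_add_one, Finset.filter_insert]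
    by_cases h : (N + 1) % 2 = e
    · have hN : ¬ N % 2 = e := by omega
      rw [if_pos h, Finset.sum_insert (by simp), if_neg (Nat.succ_ne_zero N), Nat.add_sub_cancel, if_pos h, if_neg hN] at *
      -- `d·(q^N (q+1) + Σ) + 1 = d q^N (q+1) + (d Σ + 1) = d q^N(q+1) + q^N = q^N (d(q+1) + 1) = q^N q²`
      rw [mul_add, add_assoc, ih, Nat.add_zero, pow_add]
      ring
    · have hN : N % 2 = e := by omega
      rw [if_neg h, if_neg h, Nat.add_zero, ih, if_pos hN]

/-- **The per-class count in `ℚ`**: `Σ_{j ≤ N, j ≡ e} w(j) = (q^{N + [N ≡ e]} − 1)∕(q − 1)` for `2 ≤ q`. [cite: Serre1980Trees, Ch. II §1.1] [cite: Flicker1998UnitaryFL, §6 p. 95] -/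
theorem cast_paritySum_eq_div {q : ℕ} (hq : 2 ≤ q) {e : ℕ} (he : e ≤ 1) (N : ℕ) :
    (((∑ j ∈ (range (N + 1)).filter (fun j => j % 2 = e), (if j = 0 then 1 else q ^ (j - 1) * (q + 1))) : ℕ) : ℚ) =
      ((q : ℚ) ^ (N + if N % 2 = e then 1 else 0) - 1) / ((q : ℚ) - 1) := by
  have hq1 : ((q : ℚ) - 1) ≠ 0 := by
    have : (2 : ℚ) ≤ q := by exact_mod_cast hq
    linarith
  have h1 : 1 ≤ q := le_trans (by norm_num) hq
  have h := pred_mul_paritySum_add_one h1 he N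
  rw [eq_div_iff hq1]
  have h' := congrArg (fun n : ℕ => (n : ℚ)) h
  simp only [Nat.cast_add, Nat.cast_mul, Nat.cast_sub h1, Nat.cast_one, Nat.cast_pow] at h'
  linarith

/-- **The germ reading of the per-class count**: `Σ_{j ≤ N, j ≡ e} w(j) = −1∕(q − 1) + (q^{[N ≡ e]}∕(q − 1)) · q^N` (`2 ≤ q`) — a NEGATIVE constant `−1∕(q−1)` (the same for both
classes `e`) plus a multiple of `q^N = |D(δ)|^{−1∕2}` whose coefficient depends only on the parity of `N`. [cite: Rogawski1990, §8.1 (8.1.1)–(8.1.2) p. 117] [cite: Flicker1998UnitaryFL, §6 p. 95] -/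
theorem cast_paritySum_eq_neg_inv_add {q : ℕ} (hq : 2 ≤ q) {e : ℕ} (he : e ≤ 1) (N : ℕ) :
    (((∑ j ∈ (range (N + 1)).filter (fun j => j % 2 = e), (if j = 0 then 1 else q ^ (j - 1) * (q + 1))) : ℕ) : ℚ) =
      -(1 / ((q : ℚ) - 1)) + ((q : ℚ) ^ (if N % 2 = e then 1 else 0) / ((q : ℚ) - 1)) * (q : ℚ) ^ N := by
  have hq1 : ((q : ℚ) - 1) ≠ 0 := by
    have : (2 : ℚ) ≤ q := by exact_mod_cast hq
    linarith
  rw [cast_paritySum_eq_div hq he N, pow_add]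
  field_simp
  ring

/-- **ALL vertices of the ball of radius `N`**: `Σ_{j ≤ N} w(j) = 1 + (q+1)(q^N − 1)∕(q − 1)` in `ℚ` (`2 ≤ q`) — the dealt form of ★ `HSideGluingSum.cast_sum_gluingWeight_eq_div`
(`= (q^N(q+1) − 2)∕(q − 1)`). [cite: Serre1980Trees, Ch. II §1.1] [cite: Flicker1998UnitaryFL, §6 p. 95] -/
theorem cast_sum_weight_eq_one_add {q : ℕ} (hq : 2 ≤ q) (N : ℕ) :
    (((∑ j ∈ range (N + 1), (if j = 0 then 1 else q ^ (j - 1) * (q + 1))) : ℕ) : ℚ) = 1 + ((q : ℚ) + 1) * ((q : ℚ) ^ N - 1) / ((q : ℚ) - 1) := by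
  have hq1 : ((q : ℚ) - 1) ≠ 0 := by
    have : (2 : ℚ) ≤ q := by exact_mod_cast hq
    linarith
  rw [HSideGluingSum.cast_sum_gluingWeight_eq_div hq N]
  field_simp
  ring

end Arithmetic

/-! ## §2 The dealt literal at the inert place `w`: ALL `γ`-fixed vertices of the tree number `1 + (q+1)(q^N − 1)∕(q − 1)` -/

section AtPlace

variable (L : Type) [Field L] [NumberField L] [IsCMField L] (v : HeightOneSpectrum (𝓞 ↥(maximalRealSubfield L)))
  (w : PlacesOver L v) (hw : IsCMField.complexConj L • w.1 = w.1)

omit [IsCMField L] in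
/-- `2 ≤ q_v = |𝓞_{L⁺} ∕ v|` (a residue ring of a number ring at a nonzero prime). [cite: Serre1980Trees, Ch. II §1.1] -/
theorem two_le_natCard_residue : 2 ≤ Nat.card (𝓞 ↥(maximalRealSubfield L) ⧸ v.asIdeal) := by
  classical
  haveI : Finite (𝓞 ↥(maximalRealSubfield L) ⧸ v.asIdeal) := Ideal.finiteQuotientOfFreeOfNeBot v.asIdeal v.ne_bot
  haveI : Nontrivial (𝓞 ↥(maximalRealSubfield L) ⧸ v.asIdeal) := Ideal.Quotient.nontrivial_iff.2 v.isPrime.ne_top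
  exact Finite.one_lt_card

include hw in
/-- **THE DEALT COUNT (all vertices, at `w`)**: `v` non-split and unramified in `L`, `γ ∈ U(σ_w, (Φ₂)_w)` elliptic unramified regular of depth `N` (eigenframe `γ P = P diag(u)`,
`u₀ ≠ u₁` of norm one, `|u₀ − u₁|_w = |ϖ_w^N|`): the `γ`-fixed vertices of the tree of `U(Φ₂)(L⁺_v)` — `γ`-stable self-dual ⊔ `γ`-stable `ϖ_w`-modular lattices — number
`#S(γ) + #M(γ) = 1 + (q_v + 1)(q_v^N − 1)∕(q_v − 1)` (★ A-p03 total ∘ §1). [cite: Kottwitz1988, §2] [cite: Serre1980Trees, Ch. II §1.1] -/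
theorem cast_ncard_fixedVertices_eq_one_add (hunr : Algebra.IsUnramifiedIn (𝓞 L) v.asIdeal)
    {γ P : GL (Fin 2) (w.1.adicCompletion L)} {u : Fin 2 → w.1.adicCompletion L}
    (hγ : γ ∈ Literature.AlgebraicGeometry.ShimuraVarieties.unitaryGroup (galAdicCompletionMap (L := L) (IsCMField.complexConj L) hw)
      (placeForm (Matrix.of fun i j : Fin 2 => if i.val + j.val + 1 = 2 then (1 : L) else 0) w.1))
    (hP : (γ : Matrix (Fin 2) (Fin 2) (w.1.adicCompletion L)) * P = P * diagonal u) (hu : Function.Injective u)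
    (hu1 : ∀ i, galAdicCompletionMap (L := L) (IsCMField.complexConj L) hw (u i) * u i = 1) {N : ℕ}
    (hN : valuation (w.1.adicCompletion L) (u 0 - u 1) =
      valuation (w.1.adicCompletion L) (toPlace v w (HeckeCharacter.uniformizer ↥(maximalRealSubfield L) v : v.adicCompletion ↥(maximalRealSubfield L)) ^ N)) :
    (({Λ : Submodule 𝒪[w.1.adicCompletion L] (Fin 2 → w.1.adicCompletion L) |
          (∃ g : GL (Fin 2) (w.1.adicCompletion L),
            (∃ J' ∈ glInt 2 (w.1.adicCompletion L), (J' : Matrix (Fin 2) (Fin 2) (w.1.adicCompletion L)) =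
              formCongr (galAdicCompletionMap (L := L) (IsCMField.complexConj L) hw) g
                (placeForm (Matrix.of fun i j : Fin 2 => if i.val + j.val + 1 = 2 then (1 : L) else 0) w.1)) ∧
            Λ = Submodule.span 𝒪[w.1.adicCompletion L] (Set.range ((g : Matrix (Fin 2) (Fin 2) (w.1.adicCompletion L)))ᵀ)) ∧
          Λ.map ((Matrix.toLin' ((γ : GL (Fin 2) (w.1.adicCompletion L)) : Matrix (Fin 2) (Fin 2) (w.1.adicCompletion L))).restrictScalars
            𝒪[w.1.adicCompletion L]) = Λ}.ncard +
      {Λ : Submodule 𝒪[w.1.adicCompletion L] (Fin 2 → w.1.adicCompletion L) |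
          (∃ g : GL (Fin 2) (w.1.adicCompletion L),
            (∃ J' ∈ glInt 2 (w.1.adicCompletion L),
              (toPlace v w (HeckeCharacter.uniformizer ↥(maximalRealSubfield L) v : v.adicCompletion ↥(maximalRealSubfield L))) •
                  (J' : Matrix (Fin 2) (Fin 2) (w.1.adicCompletion L)) =
                formCongr (galAdicCompletionMap (L := L) (IsCMField.complexConj L) hw) g
                  (placeForm (Matrix.of fun i j : Fin 2 => if i.val + j.val + 1 = 2 then (1 : L) else 0) w.1)) ∧
            Λ = Submodule.span 𝒪[w.1.adicCompletion L] (Set.range ((g : Matrix (Fin 2) (Fin 2) (w.1.adicCompletion L)))ᵀ)) ∧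
          Λ.map ((Matrix.toLin' ((γ : GL (Fin 2) (w.1.adicCompletion L)) : Matrix (Fin 2) (Fin 2) (w.1.adicCompletion L))).restrictScalars
            𝒪[w.1.adicCompletion L]) = Λ}.ncard : ℕ) : ℚ) =
      1 + ((Nat.card (𝓞 ↥(maximalRealSubfield L) ⧸ v.asIdeal) : ℚ) + 1) *
        ((Nat.card (𝓞 ↥(maximalRealSubfield L) ⧸ v.asIdeal) : ℚ) ^ N - 1) / ((Nat.card (𝓞 ↥(maximalRealSubfield L) ⧸ v.asIdeal) : ℚ) - 1) := by
  rw [ncard_selfDualStable_add_ncard_modularStable_antidiagTwo_eq_sum_at L v w hw hunr hγ hP hu hu1 hN]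
  exact cast_sum_weight_eq_one_add (two_le_natCard_residue L v) N

end AtPlace

/-! ## §3 On the CM carrier `U₂ = U(Φ₂)(L⁺_v)`: `#Fix_δ(U₂ ⧸ K₂)` — the reading of `Φ(δ, 1_{K₂})` — is the parity sum, in closed form -/

section Carrier

variable (L : Type) [Field L] [NumberField L] [IsCMField L] (v : HeightOneSpectrum (𝓞 ↥(maximalRealSubfield L)))
  (w : PlacesOver L v) (hw : IsCMField.complexConj L • w.1 = w.1)

include hw in
/-- **`#Fix_δ(U₂ ⧸ K₂) = Σ_{j ≤ N, j ≡ e} w(q_v, j)`** for `δ ∈ U₂ = (cmDatum L 2 Φ₂).Local v` with an eigenframe `δ Q = Q · diag(u)` over `E_v = Π_{w∣v} L_w` (`u₀ ≠ u₁` of norm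
one, `|u₀ − u₁|_w = |ϖ_w^N|` at the non-split unramified `w`), for a class bit `e ∈ {0,1}` (`e = 0 ⟺` the order of the Gram entry `⟨q₀, q₀⟩` at `w` is even) — measure-free twin
of ★ `exists_classOrbitalIntegral_indicator_eq_paritySum` (CM carrier → place `w` by ★ `localNonsplitEquiv`, ★ (L5-d1) frame transport, ★ (L5-d3) normalised count).
[cite: Kottwitz1988, §2] [cite: Rogawski1990, §4.9 Prop. 4.9.1 (b) p. 55] [cite: Flicker1998UnitaryFL, §6 p. 95] -/
theorem exists_natCard_fixedBy_cmLocalIntegralLevel_two_eq_paritySum (hunr : Algebra.IsUnramifiedIn (𝓞 L) v.asIdeal)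
    (δ : (cmDatum L 2 (Matrix.of fun i j : Fin 2 => if i.val + j.val + 1 = 2 then (1 : L) else 0)).Local v)
    {Q : GL (Fin 2) (LocalRing L v)} {u : Fin 2 → LocalRing L v}
    (hQ : δ.val.val * Q.val = Q.val * diagonal u)
    (hu : Function.Injective u) (hu1 : ∀ i, conjLocal L (IsCMField.complexConj L) v (u i) * u i = 1) {N : ℕ}
    (hN : valuation (w.1.adicCompletion L) (u 0 w - u 1 w) =
      valuation (w.1.adicCompletion L) ((toPlace v w (HeckeCharacter.uniformizer ↥(maximalRealSubfield L) v : v.adicCompletion ↥(maximalRealSubfield L))) ^ N)) :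
    ∃ e : ℕ, e ≤ 1 ∧
      (Even (WithZero.log (Valued.v ((twistGram (conjLocal L (IsCMField.complexConj L) v)
        ((adelicForm L 2 (Matrix.of fun i j : Fin 2 => if i.val + j.val + 1 = 2 then (1 : L) else 0)).map (adeleToLocal L v)) Q.val 0 0) w))) ↔ e = 0) ∧
      Nat.card (MulAction.fixedBy ((cmDatum L 2 (Matrix.of fun i j : Fin 2 => if i.val + j.val + 1 = 2 then (1 : L) else 0)).Local v ⧸
          cmLocalIntegralLevel L 2 (Matrix.of fun i j : Fin 2 => if i.val + j.val + 1 = 2 then (1 : L) else 0) v) δ) =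
        ∑ j ∈ (range (N + 1)).filter (fun j => j % 2 = e),
          (if j = 0 then 1 else Nat.card (𝓞 ↥(maximalRealSubfield L) ⧸ v.asIdeal) ^ (j - 1) * (Nat.card (𝓞 ↥(maximalRealSubfield L) ⧸ v.asIdeal) + 1)) := by
  have hc1 : IsCMField.complexConj L ≠ 1 := IsCMField.complexConj_ne_one L
  -- the one-place data at `w`
  have hδw : (((localNonsplitEquiv (IsCMField.complexConj L) (Matrix.of fun i j : Fin 2 => if i.val + j.val + 1 = 2 then (1 : L) else 0) hc1 w hw δ :
      unitaryGroupOfForm (galAdicCompletionMap (L := L) (IsCMField.complexConj L) hw) (placeForm (Matrix.of fun i j : Fin 2 => if i.val + j.val + 1 = 2 then (1 : L) else 0) w.1)) :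
        GL (Fin 2) (w.1.adicCompletion L)) ∈
      Literature.AlgebraicGeometry.ShimuraVarieties.unitaryGroup (galAdicCompletionMap (L := L) (IsCMField.complexConj L) hw)
        (placeForm (Matrix.of fun i j : Fin 2 => if i.val + j.val + 1 = 2 then (1 : L) else 0) w.1)) :=
    Literature.AlgebraicGeometry.ShimuraVarieties.mem_unitaryGroup_iff.2
      (mem_unitaryGroupOfForm_iff.1 (localNonsplitEquiv (IsCMField.complexConj L) (Matrix.of fun i j : Fin 2 => if i.val + j.val + 1 = 2 then (1 : L) else 0) hc1 w hw δ).2)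
  have hQw : (((localNonsplitEquiv (IsCMField.complexConj L) (Matrix.of fun i j : Fin 2 => if i.val + j.val + 1 = 2 then (1 : L) else 0) hc1 w hw δ :
      unitaryGroupOfForm (galAdicCompletionMap (L := L) (IsCMField.complexConj L) hw) (placeForm (Matrix.of fun i j : Fin 2 => if i.val + j.val + 1 = 2 then (1 : L) else 0) w.1)) :
        GL (Fin 2) (w.1.adicCompletion L)) : Matrix (Fin 2) (Fin 2) (w.1.adicCompletion L)) *
        (Matrix.GeneralLinearGroup.map (Pi.evalRingHom (fun w' : PlacesOver L v => w'.1.adicCompletion L) w) Q :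
          Matrix (Fin 2) (Fin 2) (w.1.adicCompletion L)) =
      (Matrix.GeneralLinearGroup.map (Pi.evalRingHom (fun w' : PlacesOver L v => w'.1.adicCompletion L) w) Q :
          Matrix (Fin 2) (Fin 2) (w.1.adicCompletion L)) * diagonal fun i => u i w := by
    rw [coe_localNonsplitEquiv_apply L (Matrix.of fun i j : Fin 2 => if i.val + j.val + 1 = 2 then (1 : L) else 0) v w hw δ]
    exact map_eval_mul_eq_of_eigenframe L v w hQ
  obtain ⟨huw, hu1w⟩ := injective_eval_and_norm_one_of_eigenvalues L v w hw hu hu1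
  obtain ⟨e, γ', he, hpar, hγ', hS⟩ := exists_ncard_selfDualStable_antidiagTwo_eq_zpow_smul_one L v w hw hunr hδw hQw huw hu1w
  -- parity currency: one-place `twistGram` = CM `twistGram` read at `w`
  have hpf : twistGram (galAdicCompletionMap (L := L) (IsCMField.complexConj L) hw) (placeForm (Matrix.of fun i j : Fin 2 => if i.val + j.val + 1 = 2 then (1 : L) else 0) w.1)
      (Matrix.GeneralLinearGroup.map (Pi.evalRingHom (fun w' : PlacesOver L v => w'.1.adicCompletion L) w) Q).val 0 0 =
      (twistGram (conjLocal L (IsCMField.complexConj L) v) ((adelicForm L 2 (Matrix.of fun i j : Fin 2 => if i.val + j.val + 1 = 2 then (1 : L) else 0)).map (adeleToLocal L v)) Q.val 0 0) w := by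
    rw [← localForm_map_eval L 2 (Matrix.of fun i j : Fin 2 => if i.val + j.val + 1 = 2 then (1 : L) else 0) v w]
    exact (twistGram_apply_eval L v w hw _ _ 0 0).symm
  refine ⟨e, he, by rw [← hpf]; exact hpar, ?_⟩
  rw [natCard_fixedBy_eq_ncard_selfDualStable_antidiagTwo L v w hw hunr δ, hS, ncard_selfDualStable_zpow_smul_one_eq_sum_at L v w hw hunr hu1w hN he γ' hγ']

include hw in
/-- **(ii♭-S) INPUT, CLOSED FORM ON THE CM CARRIER: `(q_v − 1) · #Fix_δ(U₂ ⧸ K₂) + 1 = q_v^{N + [N ≡ e (2)]}`** for `δ` as above (elliptic unramified regular of depth `N` at the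
non-split unramified `v`), `e` the class bit: the orbital integral `Φ(δ, 1_{K₂}) = #Fix_δ(U₂ ⧸ K₂) · ν(K₂)` (★ `UnitOrbitalIntegralFixedPointsVolume`) is `ν(K₂)·(q^{N+[N≡e]} − 1)∕(q − 1)`,
constant term `−ν(K₂)∕(q_v − 1) < 0`. [cite: Kottwitz1988, §2] [cite: Rogawski1990, §8.1 p. 117] [cite: Flicker1998UnitaryFL, §6 p. 95] -/
theorem exists_pred_mul_natCard_fixedBy_cmLocalIntegralLevel_two_add_one_eq_pow (hunr : Algebra.IsUnramifiedIn (𝓞 L) v.asIdeal)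
    (δ : (cmDatum L 2 (Matrix.of fun i j : Fin 2 => if i.val + j.val + 1 = 2 then (1 : L) else 0)).Local v)
    {Q : GL (Fin 2) (LocalRing L v)} {u : Fin 2 → LocalRing L v}
    (hQ : δ.val.val * Q.val = Q.val * diagonal u)
    (hu : Function.Injective u) (hu1 : ∀ i, conjLocal L (IsCMField.complexConj L) v (u i) * u i = 1) {N : ℕ}
    (hN : valuation (w.1.adicCompletion L) (u 0 w - u 1 w) =
      valuation (w.1.adicCompletion L) ((toPlace v w (HeckeCharacter.uniformizer ↥(maximalRealSubfield L) v : v.adicCompletion ↥(maximalRealSubfield L))) ^ N)) :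
    ∃ e : ℕ, e ≤ 1 ∧
      (Even (WithZero.log (Valued.v ((twistGram (conjLocal L (IsCMField.complexConj L) v)
        ((adelicForm L 2 (Matrix.of fun i j : Fin 2 => if i.val + j.val + 1 = 2 then (1 : L) else 0)).map (adeleToLocal L v)) Q.val 0 0) w))) ↔ e = 0) ∧
      (Nat.card (𝓞 ↥(maximalRealSubfield L) ⧸ v.asIdeal) - 1) *
          Nat.card (MulAction.fixedBy ((cmDatum L 2 (Matrix.of fun i j : Fin 2 => if i.val + j.val + 1 = 2 then (1 : L) else 0)).Local v ⧸
            cmLocalIntegralLevel L 2 (Matrix.of fun i j : Fin 2 => if i.val + j.val + 1 = 2 then (1 : L) else 0) v) δ) + 1 =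
        Nat.card (𝓞 ↥(maximalRealSubfield L) ⧸ v.asIdeal) ^ (N + if N % 2 = e then 1 else 0) := by
  obtain ⟨e, he, hpar, hcount⟩ := exists_natCard_fixedBy_cmLocalIntegralLevel_two_eq_paritySum L v w hw hunr δ hQ hu hu1 hN
  refine ⟨e, he, hpar, ?_⟩
  rw [hcount]
  exact pred_mul_paritySum_add_one (le_trans (by norm_num) (two_le_natCard_residue L v)) he N

end Carrier

end Summit.HodgeConjecture.HodgeConjecture.Cruxes.H413.K2E3RankOneEllipticFixedPointCount

end
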